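import Mathlib.RingTheory.Valuation.Basic
import Mathlib.Algebra.Ring.Action.Basic
import Mathlib.Algebra.Order.GroupWithZero.Basic
import Mathlib.Data.Fintype.BigOperators
import Mathlib.GroupTheory.SpecificGroups.Cyclic
import Mathlib.Tactic
import HarnessLib

set_option linter.dupNamespace false -- `Summit.BirchSwinnertonDyer.BirchSwinnertonDyer.Theorems.…` (summit = sub, D-0017)
set_option autoImplicit false

/-!
# Crux `ManinDatumSupercuspidalCMInert` (stmt-BirchSwinnertonDyer-20111, BED r605), CM side of H₅ / H₇ — the TAME RESOLVENT COUNT: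
# generic algebra of the deficit `v ≥ j·v(ϖ)` for Lagrange resolvents in a totally, tamely ramified Galois layer

Route `BiquadraticEisensteinDescent` (cell `pub/bsd-wall`, width seat `bsd-wall-cm-bed-w4` g10, RESOLVENT LANE; `--supports`
stmt-BirchSwinnertonDyer-20111, helper). THEOREMS ONLY (no definition, no named fact, no `sorry`); nothing is closed by this file and BSD is
not proved by any of it.

Memo `Cruxes/ManinDatumSupercuspidalCMInert/PLAIN-ODD-57-w4g10.md` §3 reduces the CM statements H₇ (and H₅) — the residual of the registered stubs
`stub_S7` / `stub_S5` after `…OfPlainOddInstances` — to ONE new brick: the `7`-adic (resp. `5`-adic) valuation of the character sums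
`R_k(w) = Σ_t q(t)^k E₁*(w + t/7)`, which after smoothing are LAGRANGE RESOLVENTS `Σ_σ χ(σ)⁻¹ σ(y)` of an integral element `y` of the
`7`-torsion layer `F = ℚ₇(i)(E₀[M′], E₀[7])` over `K′ = ℚ₇(i)(E₀[M′])`, a totally and tamely ramified cyclic extension of degree `48`. This file
proves the PURELY ALGEBRAIC part of step (e) of that plan, for an arbitrary valued field with a finite group of isometries — no elliptic curve,
no local field theory, no integral basis:

* `smul_resolvent` — equivariance `τ • R = χ(τ) · R` of the resolvent `R = Σ_σ χ(σ)⁻¹ · σ • y` (`χ` a multiplicative, `G`-fixed character);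
* ★ `resolvent_valuation_le` — **the tame count**: if `G` acts on the valued field `(F, v)` by isometries and TRIVIALLY ON THE RESIDUE RING
  (`v(σx − x) < 1` whenever `v x ≤ 1`), `ϖ ∈ F` has `v ϖ < 1` generating the value group (`v x ∈ v(ϖ)^ℤ` for `x ≠ 0`), the «tame character»
  `θ(σ) = σϖ/ϖ` has exact order `e` modulo the maximal ideal (`θ(σ)^m ≡ 1 ∀σ ⇒ e ∣ m`), and `χ ≡ θ^j` modulo the maximal ideal with
  `j < e`, then for every `v`-integral `y`: `v(Σ_σ χ(σ)⁻¹ σ•y) ≤ v(ϖ)^j` — i.e. additively `ord(R) ≥ j·ord(ϖ)`. (Proof: `R/ϖ^n` is a unit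
  for `v R = v(ϖ)^n`; `G` fixes units residually, so `θ^{j−n} ≡ 1`, `e ∣ n − j`; integrality `n ≥ 0` and `j < e` force `n ≥ j`.)
* `valuation_root_of_eisenstein` — step (c)'s elementary input: a root `α` of a monic polynomial whose lower coefficients `a_i` satisfy
  `v(a_i) ≤ v(a_0) < 1` (Eisenstein shape) has `v(α)^n = v(a_0)` (so a root of a degree-`24` Eisenstein polynomial at `7` has `ord₇ = 1/24`).

In the application (memo §3): `e = 48`, `θ` = the tame character of `F/K′` (injective by total tame ramification), `χ = (q^k ∘ u)⁻¹ = θ^{48−12k}`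
(`a ≡ 1 (mod 4)` from `[i]`), so `ord₇ ≥ (48 − 12k)/48 = 1 − k/4` — exactly the deficit absorbed by `|A|^{1/4}` in `Ω⁻(E_A)`; at `p = 3` the same
lemma with `e = 8`, `j = 8 − 2k` is the «μ₈-resolvent count» of crux `InertBadAtThree`'s memo EPSILON-RESOLVED §8.
References: [Serre1979] (Local Fields) Ch. IV §2 Prop. 7 (the tame character `θ₀`), Ch. I §6 (Eisenstein polynomials);
[CasselsFrohlich1967] Ch. I §5–§6 (tamely ramified extensions); Lagrange resolvents as in Fröhlich's Galois module theory.
-/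

noncomputable section

open scoped BigOperators

namespace Summit.BirchSwinnertonDyer.BirchSwinnertonDyer.Theorems.BiquadraticEisensteinDescentManinDatumSupercuspidalCMInertTameResolvent

section Resolvent

variable {F Γ₀ : Type*} [Field F] [LinearOrderedCommGroupWithZero Γ₀] (v : Valuation F Γ₀)
  {G : Type*} [Group G] [Fintype G] [MulSemiringAction G F]

omit [Fintype G] [MulSemiringAction G F] in
/-- A multiplicative character with non-zero values has `χ 1 = 1`. [folklore] -/
theorem char_one_eq_one (χ : G → F) (hχ : ∀ σ τ, χ (σ * τ) = χ σ * χ τ) (hχ0 : ∀ σ, χ σ ≠ 0) : χ 1 = 1 := by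
  have h := hχ 1 1
  rw [one_mul] at h
  exact (mul_eq_left₀ (hχ0 1)).mp h.symm

omit [Fintype G] [MulSemiringAction G F] in
/-- A multiplicative character with non-zero values has `χ σ⁻¹ = (χ σ)⁻¹`. [folklore] -/
theorem char_inv (χ : G → F) (hχ : ∀ σ τ, χ (σ * τ) = χ σ * χ τ) (hχ0 : ∀ σ, χ σ ≠ 0) (σ : G) :
    χ σ⁻¹ = (χ σ)⁻¹ := by
  have h := hχ σ⁻¹ σ
  rw [inv_mul_cancel, char_one_eq_one χ hχ hχ0] at h
  exact eq_inv_of_mul_eq_one_left h.symm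

omit [Fintype G] in
/-- `G` acts on the values of a `G`-fixed character trivially also through inverses: `τ • (χ σ)⁻¹ = (χ σ)⁻¹`. [folklore] -/
theorem smul_char_inv (χ : G → F) (hχfix : ∀ σ τ : G, σ • χ τ = χ τ) (τ σ : G) :
    τ • (χ σ)⁻¹ = (χ σ)⁻¹ := by
  rw [smul_inv'', hχfix]

/-- **Equivariance of the Lagrange resolvent**: for a multiplicative `G`-fixed character `χ` with non-zero values and any `y`,
`τ • (Σ_σ χ(σ)⁻¹ · σ•y) = χ(τ) · Σ_σ χ(σ)⁻¹ · σ•y`. [cite: Serre1979, Ch. IV §2 Prop. 7] -/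
theorem smul_resolvent (χ : G → F) (hχ : ∀ σ τ, χ (σ * τ) = χ σ * χ τ) (hχ0 : ∀ σ, χ σ ≠ 0)
    (hχfix : ∀ σ τ : G, σ • χ τ = χ τ) (y : F) (τ : G) :
    τ • (∑ σ, (χ σ)⁻¹ * σ • y) = χ τ * ∑ σ, (χ σ)⁻¹ * σ • y := by
  rw [Finset.smul_sum, Finset.mul_sum]
  -- `τ • (χ(σ)⁻¹ · σ•y) = χ(σ)⁻¹ · (τσ)•y`
  have hterm : ∀ σ : G, τ • ((χ σ)⁻¹ * σ • y) = (χ σ)⁻¹ * (τ * σ) • y := fun σ ↦ by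
    rw [smul_mul', smul_char_inv χ hχfix, mul_smul]
  simp_rw [hterm]
  -- reindex `σ ↦ τσ`
  rw [show ∑ σ : G, (χ σ)⁻¹ * (τ * σ) • y = ∑ σ : G, (χ (τ⁻¹ * σ))⁻¹ * σ • y from
    (Fintype.sum_bijective (fun σ ↦ τ * σ) (Group.mulLeft_bijective τ) _ _ (fun σ ↦ by
      simp only [inv_mul_cancel_left]))]
  refine Finset.sum_congr rfl fun σ _ ↦ ?_
  rw [hχ, char_inv χ hχ hχ0, mul_inv, inv_inv, mul_assoc]

/-- `v(a − 1) < 1` forces `v a = 1`. [folklore] -/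
theorem val_eq_one_of_near_one {a : F} (h : v (a - 1) < 1) : v a = 1 := by
  have := Valuation.map_one_add_of_lt v h
  rwa [add_sub_cancel] at this

/-- Products of elements `≡ 1` modulo the maximal ideal are `≡ 1`. [folklore] -/
theorem near_one_mul {a b : F} (ha : v (a - 1) < 1) (hb : v (b - 1) < 1) : v (a * b - 1) < 1 := by
  have hva : v a = 1 := val_eq_one_of_near_one v ha
  have : a * b - 1 = a * (b - 1) + (a - 1) := by ring
  rw [this]
  refine Valuation.map_add_lt v ?_ ha
  rw [Valuation.map_mul, hva, one_mul]
  exact hb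

/-- Inverses of elements `≡ 1` modulo the maximal ideal are `≡ 1`. [folklore] -/
theorem near_one_inv {a : F} (ha : v (a - 1) < 1) : v (a⁻¹ - 1) < 1 := by
  have hva : v a = 1 := val_eq_one_of_near_one v ha
  have ha0 : a ≠ 0 := by intro h; rw [h, Valuation.map_zero] at hva; exact zero_ne_one hva
  have : a⁻¹ - 1 = -(a⁻¹ * (a - 1)) := by field_simp; ring
  rw [this, Valuation.map_neg, Valuation.map_mul, map_inv₀, hva, inv_one, one_mul]
  exact ha

/-- Integer powers of elements `≡ 1` modulo the maximal ideal are `≡ 1`. [folklore] -/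
theorem near_one_zpow {a : F} (ha : v (a - 1) < 1) (m : ℤ) : v (a ^ m - 1) < 1 := by
  have ha0 : a ≠ 0 := by
    intro h; rw [h, zero_sub, Valuation.map_neg, Valuation.map_one] at ha; exact lt_irrefl _ ha
  induction m using Int.induction_on with
  | zero => simp
  | succ n ih =>
    rw [zpow_add_one₀ ha0]
    exact near_one_mul v ih ha
  | pred n ih =>
    rw [zpow_sub_one₀ ha0]
    exact near_one_mul v ih (near_one_inv v ha)

/-- If `v(a − b) < 1` and `v b = 1` then `v(a/b − 1) < 1`. [folklore] -/
theorem near_one_div_of_sub_lt {a b : F} (h : v (a - b) < 1) (hb : v b = 1) : v (a / b - 1) < 1 := by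
  have hb0 : b ≠ 0 := by intro h0; rw [h0, Valuation.map_zero] at hb; exact zero_ne_one hb
  have : a / b - 1 = (a - b) / b := by field_simp
  rw [this, map_div₀, hb, div_one]
  exact h

/-- ★ **The tame resolvent count.** Let `G` (finite) act on the valued field `(F, v)` by isometries and trivially on the residue ring
(`v(σ•x − x) < 1` for `v x ≤ 1`); let `ϖ ≠ 0`, `v ϖ < 1`, generate the value group (`∀ x ≠ 0, v x = v(ϖ)^m` for some `m ∈ ℤ`); suppose the
tame character `θ(σ) = σ•ϖ/ϖ` has exact order `e` modulo the maximal ideal (`(∀ σ, v(θ(σ)^m − 1) < 1) → e ∣ m`) and `χ : G → F` is a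
multiplicative, `G`-fixed character of valuation `1` with `v(χ(σ) − θ(σ)^j) < 1` for all `σ`, where `j < e`. Then for every `y` with `v y ≤ 1`:
`v(Σ_σ χ(σ)⁻¹ · σ•y) ≤ v(ϖ)^j`. (Additively: the resolvent of an INTEGRAL element for the character `θ^j` has `ord ≥ j·ord(ϖ)`; no integral
basis and no Kummer generator are used — only that `G` fixes units residually.) [cite: Serre1979, Ch. IV §2 Prop. 7] [cite: CasselsFrohlich1967, Ch. I §5–§6] -/
theorem resolvent_valuation_le (hv : ∀ (σ : G) (x : F), v (σ • x) = v x)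
    (hres : ∀ (σ : G) (x : F), v x ≤ 1 → v (σ • x - x) < 1)
    {ϖ : F} (hϖ0 : ϖ ≠ 0) (hϖ1 : v ϖ < 1) (hgen : ∀ x : F, x ≠ 0 → ∃ m : ℤ, v x = v ϖ ^ m)
    {e : ℕ} (hθ : ∀ m : ℤ, (∀ σ : G, v ((σ • ϖ / ϖ) ^ m - 1) < 1) → (e : ℤ) ∣ m)
    (χ : G → F) (hχ : ∀ σ τ, χ (σ * τ) = χ σ * χ τ) (hχ1 : ∀ σ, v (χ σ) = 1) (hχfix : ∀ σ τ : G, σ • χ τ = χ τ)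
    {j : ℕ} (hj : j < e) (hχθ : ∀ σ, v (χ σ - (σ • ϖ / ϖ) ^ j) < 1)
    {y : F} (hy : v y ≤ 1) :
    v (∑ σ, (χ σ)⁻¹ * σ • y) ≤ v ϖ ^ j := by
  have hχ0 : ∀ σ, χ σ ≠ 0 := fun σ h ↦ by
    have := hχ1 σ; rw [h, Valuation.map_zero] at this; exact zero_ne_one this
  set R : F := ∑ σ, (χ σ)⁻¹ * σ • y with hRdef
  by_cases hR0 : R = 0
  · rw [hR0, Valuation.map_zero]; exact zero_le
  have hvϖ0 : 0 < v ϖ := lt_of_le_of_ne zero_le (Ne.symm ((Valuation.ne_zero_iff v).mpr hϖ0))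
  -- `R` is integral
  have hRint : v R ≤ 1 := by
    refine Valuation.map_sum_le v fun σ _ ↦ ?_
    rw [Valuation.map_mul, map_inv₀, hχ1, inv_one, one_mul, hv]
    exact hy
  -- the tame character `θ`
  set θ : G → F := fun σ ↦ σ • ϖ / ϖ with hθdef
  have hθϖ : ∀ σ, σ • ϖ = θ σ * ϖ := fun σ ↦ by rw [hθdef]; exact (div_mul_cancel₀ _ hϖ0).symm
  have hθv : ∀ σ, v (θ σ) = 1 := fun σ ↦ by
    rw [hθdef, map_div₀, hv, div_self ((Valuation.ne_zero_iff v).mpr hϖ0)]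
  have hθ0 : ∀ σ, θ σ ≠ 0 := fun σ h ↦ by
    have := hθv σ; rw [h, Valuation.map_zero] at this; exact zero_ne_one this
  have hθzpow : ∀ (σ : G) (m : ℤ), σ • ϖ ^ m = θ σ ^ m * ϖ ^ m := fun σ m ↦ by
    rw [← MulSemiringAction.toRingHom_apply G F σ, map_zpow₀, MulSemiringAction.toRingHom_apply, hθϖ, mul_zpow]
  -- equivariance of `R`
  have hRτ : ∀ τ : G, τ • R = χ τ * R := smul_resolvent χ hχ hχ0 hχfix y
  -- `v R = v ϖ ^ n`
  obtain ⟨n, hn⟩ := hgen R hR0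
  -- the unit `x₀ = R / ϖ^n`
  set x₀ : F := R / ϖ ^ n with hx₀def
  have hϖn0 : ϖ ^ n ≠ 0 := zpow_ne_zero n hϖ0
  have hx₀v : v x₀ = 1 := by
    rw [hx₀def, map_div₀, map_zpow₀, hn, div_self (zpow_ne_zero n hvϖ0.ne')]
  have hx₀0 : x₀ ≠ 0 := fun h ↦ by rw [h, Valuation.map_zero] at hx₀v; exact zero_ne_one hx₀v
  -- `τ • x₀ = (χ τ · θ τ ^ (−n)) · x₀`
  have hx₀τ : ∀ τ : G, τ • x₀ = (χ τ * (θ τ ^ n)⁻¹) * x₀ := fun τ ↦ by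
    rw [hx₀def, ← MulSemiringAction.toRingHom_apply G F τ, map_div₀, MulSemiringAction.toRingHom_apply,
      MulSemiringAction.toRingHom_apply, hRτ, hθzpow]
    field_simp
  -- hence `θ τ ^ (n − j) ≡ 1`
  have hnear : ∀ τ : G, v (θ τ ^ (n - (j : ℤ)) - 1) < 1 := by
    intro τ
    have h1 : v (χ τ * (θ τ ^ n)⁻¹ - 1) < 1 := by
      have h := hres τ x₀ hx₀v.le
      rw [hx₀τ, ← sub_one_mul, Valuation.map_mul, hx₀v, mul_one] at h
      exact h
    have h2 : v (χ τ / θ τ ^ (j : ℤ) - 1) < 1 :=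
      near_one_div_of_sub_lt v (by rw [zpow_natCast]; exact hχθ τ) (by rw [map_zpow₀, hθv, one_zpow])
    have h3 := near_one_mul v (near_one_inv v h1) h2
    have heq : (χ τ * (θ τ ^ n)⁻¹)⁻¹ * (χ τ / θ τ ^ (j : ℤ)) = θ τ ^ (n - (j : ℤ)) := by
      rw [zpow_sub₀ (hθ0 τ)]
      field_simp
      rw [mul_div_mul_left _ _ (hχ0 τ)]
    rw [heq] at h3
    exact h3
  -- so `e ∣ n − j`
  have hdvd : (e : ℤ) ∣ n - (j : ℤ) := hθ _ hnear
  -- integrality: `0 ≤ n`; with `j < e` this forces `j ≤ n`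
  have hn0 : 0 ≤ n := by
    have h := hRint
    rw [hn] at h
    exact (zpow_le_one_iff_right_of_lt_one₀ hvϖ0 hϖ1).mp h
  have hjn : (j : ℤ) ≤ n := by
    obtain ⟨q, hq⟩ := hdvd
    have he0 : (0 : ℤ) < e := by exact_mod_cast (Nat.lt_of_le_of_lt (Nat.zero_le j) hj)
    have hje : (j : ℤ) < e := by exact_mod_cast hj
    have hq0 : 0 ≤ q := by
      by_contra hq1
      push Not at hq1
      have : (e : ℤ) * q ≤ (e : ℤ) * (-1) := mul_le_mul_of_nonneg_left (by omega) he0.le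
      linarith
    nlinarith
  -- conclude
  rw [hn, ← zpow_natCast]
  exact (zpow_le_zpow_iff_right_of_lt_one₀ hvϖ0 hϖ1).mpr hjn

end Resolvent

/-! ## Roots of Eisenstein-shaped polynomials -/

section Eisenstein

variable {F Γ₀ : Type*} [Field F] [LinearOrderedCommGroupWithZero Γ₀] (v : Valuation F Γ₀)

/-- **Valuation of a root of an Eisenstein-shaped monic polynomial.** If `α^n = −Σ_{i<n} a_i α^i` (i.e. `α` is a root of
`X^n + a_{n−1}X^{n−1} + ⋯ + a_0`) with `v(a_i) ≤ v(a_0) < 1` for all `i < n` and `0 < n`, then `v(α)^n = v(a_0)`. In particular a root of a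
degree-`n` Eisenstein polynomial over a discretely valued field has normalised valuation `1/n` (memo PLAIN-ODD-57 §3(c): the reversed
`7`-division polynomial of `y² = x³ − x`, `n = 24`). [cite: CasselsFrohlich1967, Ch. I §6 Thm. 1] [cite: Serre1979, Ch. I §6] -/
theorem valuation_root_of_eisenstein {n : ℕ} (hn : 0 < n) (a : ℕ → F) {α : F}
    (hroot : α ^ n = -∑ i ∈ Finset.range n, a i * α ^ i)
    (ha : ∀ i < n, v (a i) ≤ v (a 0)) (ha0 : v (a 0) < 1) :
    v α ^ n = v (a 0) := by
  -- first `v α < 1`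
  have hα1 : v α < 1 := by
    by_contra hge
    push Not at hge
    have hαpos : 0 < v α := lt_of_lt_of_le zero_lt_one hge
    -- every term has valuation `< v α ^ n`
    have hlt : v (∑ i ∈ Finset.range n, a i * α ^ i) < v α ^ n := by
      refine Valuation.map_sum_lt v (pow_ne_zero n hαpos.ne') fun i hi ↦ ?_
      rw [Finset.mem_range] at hi
      rw [Valuation.map_mul, Valuation.map_pow]
      calc v (a i) * v α ^ i ≤ v (a 0) * v α ^ i := mul_le_mul_left (ha i hi) _
        _ < 1 * v α ^ i := by
            exact mul_lt_mul_of_pos_right ha0 (pow_pos hαpos i)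
        _ = v α ^ i := one_mul _
        _ ≤ v α ^ n := pow_le_pow_right₀ hge hi.le
    have := congrArg v hroot
    rw [Valuation.map_pow, Valuation.map_neg] at this
    exact absurd this (ne_of_gt hlt)
  -- now the constant term dominates
  have hsplit : ∑ i ∈ Finset.range n, a i * α ^ i = a 0 + ∑ i ∈ Finset.range (n - 1), a (i + 1) * α ^ (i + 1) := by
    obtain ⟨k, rfl⟩ : ∃ k, n = k + 1 := ⟨n - 1, by omega⟩
    rw [Finset.sum_range_succ', pow_zero, mul_one, add_comm]
    simp
  by_cases ha00 : v (a 0) = 0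
  · -- degenerate case: all coefficients vanish, so `α = 0`
    have hterms : ∀ i ∈ Finset.range n, v (a i * α ^ i) ≤ 0 := fun i hi ↦ by
      rw [Finset.mem_range] at hi
      rw [Valuation.map_mul]
      calc v (a i) * v (α ^ i) ≤ v (a 0) * v (α ^ i) := mul_le_mul_left (ha i hi) _
        _ = 0 := by rw [ha00, zero_mul]
    have hsum0 : v (∑ i ∈ Finset.range n, a i * α ^ i) ≤ 0 := Valuation.map_sum_le v hterms
    have hαn : v α ^ n = 0 := by
      have h := congrArg v hroot
      rw [Valuation.map_pow, Valuation.map_neg] at h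
      exact le_antisymm (h ▸ hsum0) zero_le
    rw [hαn, ha00]
  · have htail : v (∑ i ∈ Finset.range (n - 1), a (i + 1) * α ^ (i + 1)) < v (a 0) := by
      refine Valuation.map_sum_lt v ha00 fun i hi ↦ ?_
      rw [Finset.mem_range] at hi
      rw [Valuation.map_mul, Valuation.map_pow]
      calc v (a (i + 1)) * v α ^ (i + 1) ≤ v (a 0) * v α ^ (i + 1) := mul_le_mul_left (ha (i + 1) (by omega)) _
        _ < v (a 0) * 1 := by
            refine mul_lt_mul_of_pos_left (pow_lt_one₀ zero_le hα1 (by omega)) ?_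
            exact lt_of_le_of_ne zero_le (Ne.symm ha00)
        _ = v (a 0) := mul_one _
    have h := congrArg v hroot
    rw [Valuation.map_pow, Valuation.map_neg, hsplit, Valuation.map_add_eq_of_lt_left v htail] at h
    exact h

end Eisenstein

/-! ## The exact-order hypothesis from an injective character into prime-to-`p` roots of unity (appended, same seat) -/

section ExactOrder

variable {F Γ₀ : Type*} [Field F] [LinearOrderedCommGroupWithZero Γ₀] (v : Valuation F Γ₀)

/-- **Roots of unity of order prime to the residue characteristic are distinct modulo the maximal ideal**: if `ζ^N = 1` with
`v(N) = 1` and `v(ζ − 1) < 1`, then `ζ = 1` (`(ζ^N − 1)/(ζ − 1) = Σ_{i<N} ζ^i ≡ N` is a unit). [cite: Serre1979, Ch. IV §2 Prop. 7] -/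
theorem eq_one_of_pow_eq_one_of_near_one {ζ : F} {N : ℕ} (hN : v (N : F) = 1) (hζN : ζ ^ N = 1)
    (hζ : v (ζ - 1) < 1) : ζ = 1 := by
  have hgeom : (ζ - 1) * ∑ i ∈ Finset.range N, ζ ^ i = ζ ^ N - 1 := by
    rw [mul_comm, geom_sum_mul]
  have hsum : v (∑ i ∈ Finset.range N, ζ ^ i) = 1 := by
    have hdiff : v (∑ i ∈ Finset.range N, ζ ^ i - (N : F)) < 1 := by
      have : ∑ i ∈ Finset.range N, ζ ^ i - (N : F) = ∑ i ∈ Finset.range N, (ζ ^ i - 1) := by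
        rw [Finset.sum_sub_distrib]; simp
      rw [this]
      refine Valuation.map_sum_lt v one_ne_zero fun i _ ↦ ?_
      have := near_one_zpow v hζ i
      rwa [zpow_natCast] at this
    have := Valuation.map_add_eq_of_lt_left v (hN ▸ hdiff : v (∑ i ∈ Finset.range N, ζ ^ i - (N : F)) < v (N : F))
    rw [add_sub_cancel] at this
    rw [this, hN]
  have h0 : (ζ - 1) * ∑ i ∈ Finset.range N, ζ ^ i = 0 := by rw [hgeom, hζN, sub_self]
  rcases mul_eq_zero.mp h0 with h | h
  · exact sub_eq_zero.mp h
  · rw [h, Valuation.map_zero] at hsum; exact absurd hsum zero_ne_one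

variable {G : Type*} [Group G] [Fintype G]

/-- **The exact-order hypothesis `hθ` of `resolvent_valuation_le`, discharged from an injective character.** If `G` is cyclic and
`θ ≡ ζ` modulo the maximal ideal for a multiplicative `ζ : G → F` with `v(ζ σ) = 1`, `ζ(σ)^N = 1` for some `N` with `v(N) = 1`
(roots of unity of order prime to the residue characteristic) and `ζ σ = 1 → σ = 1`, then `(∀ σ, v(θ(σ)^m − 1) < 1) → |G| ∣ m`. In the
application `ζ` = the Teichmüller lift of the tame character of `ℚ₇(i)(E₀[7])/ℚ₇(i)(E₀[M′])` (values in `μ₄₈ ⊂ ℤ₇[i]`, `N = 48`).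
[cite: Serre1979, Ch. IV §2 Prop. 7] -/
theorem card_dvd_of_forall_near_one [IsCyclic G] (θ ζ : G → F) (hθζ : ∀ σ, v (θ σ - ζ σ) < 1)
    (hζmul : ∀ σ τ, ζ (σ * τ) = ζ σ * ζ τ) (hζ1 : ∀ σ, v (ζ σ) = 1) {N : ℕ} (hN : v (N : F) = 1)
    (hζN : ∀ σ, ζ σ ^ N = 1) (hζinj : ∀ σ, ζ σ = 1 → σ = 1) {m : ℤ}
    (hm : ∀ σ : G, v (θ σ ^ m - 1) < 1) : (Fintype.card G : ℤ) ∣ m := by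
  have hζ0 : ∀ σ, ζ σ ≠ 0 := fun σ h ↦ by
    have := hζ1 σ; rw [h, Valuation.map_zero] at this; exact zero_ne_one this
  have hζone : ζ 1 = 1 := by
    have h := hζmul 1 1
    rw [one_mul] at h
    exact (mul_eq_left₀ (hζ0 1)).mp h.symm
  have hζzpow : ∀ (σ : G) (k : ℤ), ζ (σ ^ k) = ζ σ ^ k := by
    intro σ k
    let φ : G →* F := { toFun := ζ, map_one' := hζone, map_mul' := hζmul }
    exact map_zpow φ σ k
  -- every `σ ^ m = 1`
  have hpow : ∀ σ : G, σ ^ m = 1 := by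
    intro σ
    have hθv : v (θ σ) = 1 := by
      have h := Valuation.map_add_eq_of_lt_left v (show v (θ σ - ζ σ) < v (ζ σ) by rw [hζ1]; exact hθζ σ)
      rw [add_sub_cancel, hζ1] at h
      exact h
    have hθ0 : θ σ ≠ 0 := fun h0 ↦ by rw [h0, Valuation.map_zero] at hθv; exact zero_ne_one hθv
    have h1 : v (θ σ / ζ σ - 1) < 1 := by
      rw [div_sub_one (hζ0 σ), map_div₀, hζ1, div_one]; exact hθζ σ
    have h2 : v ((θ σ / ζ σ) ^ m - 1) < 1 := near_one_zpow v h1 m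
    have h3 : v (ζ σ ^ m - 1) < 1 := by
      have h4 := near_one_mul v (near_one_inv v h2) (hm σ)
      have heq : ((θ σ / ζ σ) ^ m)⁻¹ * θ σ ^ m = ζ σ ^ m := by
        rw [div_zpow, inv_div, div_mul_cancel₀ _ (zpow_ne_zero m hθ0)]
      rw [heq] at h4
      exact h4
    have h5 : ζ (σ ^ m) = 1 := by
      rw [hζzpow]
      refine eq_one_of_pow_eq_one_of_near_one v hN ?_ h3
      rw [← zpow_natCast, ← zpow_mul, mul_comm, zpow_mul, zpow_natCast, hζN, one_zpow]
    exact hζinj _ h5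
  -- cyclic: a generator has order `|G|`
  obtain ⟨g, hg⟩ := IsCyclic.exists_ofOrder_eq_natCard (α := G)
  rw [Nat.card_eq_fintype_card] at hg
  rw [← hg]
  exact orderOf_dvd_iff_zpow_eq_one.mpr (hpow g)

end ExactOrder

end Summit.BirchSwinnertonDyer.BirchSwinnertonDyer.Theorems.BiquadraticEisensteinDescentManinDatumSupercuspidalCMInertTameResolvent

end
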